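import Literature.MathematicalPhysics.QuantumFieldTheory.Federbush1986.PureAverages
import Literature.MathematicalPhysics.QuantumFieldTheory.Federbush1986.AbelianModeEstimates

/-!
# Federbush, *A phase cell approach to Yang–Mills theory* VI. *Non-abelian lattice-continuum duality* (Ann. Inst. H.
# Poincaré 47 (1987) 17–23) — the block spin transformation (1)–(6), `g₀(e, A)` (7), the Definition «associated» (8)–(9),
# THEOREM 1 (existence and uniqueness), the action (10), THEOREM 2 (convergence of the lattice actions), the two-run
# construction (11)–(12), the small-field analytic structure (13)–(23), the final inductive bounds (24)–(28) and the
# two-data bound (29)–(31): TYPED STATEMENTS with citation tags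

statement-level skeleton of published theorems with citation tags; proofs where landed; nothing here is a claim about the Yang–Mills mass gap

Cell `lit-balaban`, reader/typer block **r17 = Federbush**; SKELETON rows `F6-…` of
`run/shared/lean/pub/lit-balaban/lit-balaban-r17/SKELETON-r17.md`.

**Source.** P. Federbush, *A phase cell approach to Yang–Mills theory. VI. Non-abelian lattice-continuum duality*, Ann.
Inst. H. Poincaré Phys. Théor. **47** (1987) 17–23 [bib `Federbush1987PhaseCellVI`; Numdam AIHPA_1987__47_1_17_0]; journal
page = PDF page + 16.  Pages READ AS IMAGES (all of pp. 18–23): renders `run/shared/lean/pub/pub-balaban/b2b-balaban-t4-lit-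
g16/renders/federbushVI/1987-aihp47-federbush-phase-cell-VI-nonabelian-duality-p002…p007-x4.png`.

**Why in the corpus.** The `pub-balaban` T⁴ spine's literature seat lists `[cite: Federbush1987PhaseCellVI, Thm 1 p. 20;
(13)–(23) p. 21; (24)–(28) p. 22; (29)–(31) p. 23]` as the classical precedent quoted in NOVELTY lines of NE3-R1 / NE9 /
NE2⁺ (`t4/T4-LIT2-CITABLE-NE.md` (L-8)): «non-abelian block spin = ABELIAN LINEAR PART (= part I) + analytic remainder
quadratic in the field» and the two-data sup-norm propagation (31).

**Setting, verbatim (p. 17–19).** «To each (oriented) bond of each lattice there is assigned a group element, lying in a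
compact simple Lie group, G.» «We denote the configuration (group assignments) on ℒ^r, the rth lattice of edge size
ℓ_r = 1/2^r, by ℱ^r. The block spin transformation BS_r carries ℱ^r into a configuration ℱ^{r−1} on ℒ^{r−1}. … BS_r :
ℱ̂^r → ℱ̂^{r−1}. (1)» «We let e be an edge in ℒ^r; and the two blocks, associated to the vertices of e in ℒ^{r+1}, be as
pictured in Figure 2 of I. There one has defined 2⁴ paths Γ_x in ℒ^{r+1}. To any path in a lattice, Γ, a group element is
defined, g_Γ. g_Γ = g(e₁)·g(e₂)⋯g(e_n) (2) … g(e) will be a function of the g_{Γ_x}. Specifying this function determines the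
block spin transformation. For the purposes of this paper we need only the following properties of this function … 1) The
function is continuous. 2) There is an ε > 0, such that if |g_{Γ_x}| < ε, all 2⁴ x (3) then g(e) is defined by minimizing
Σ_x d²(g(e), g_{Γ_x}). (4) Here we have let d(g₁, g₂) be the invariant distance on G arising from an invariant metric. If
u(g) = e^A with A « small » we may set d²(Id, g) = −Tr A² (5) … |g| = d(Id, g). (6) All this notation follows III. The
function as specified for « small » g in (2) above, yields « Balaban averaging. » (This definition actually differs
slightly from that used originally by Balaban.) We use the same function to define all such transformations, and thus
all the BS_r.»

**How the setting is typed (abstraction note for the referee, F6).**  The lattices, edges, plaquettes, `ℝ⁴` and partial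
derivatives are the CONCRETE ones of `Federbush1986/AbelianModeEstimates` (`Edge r`, `Plaq r`, `E4`, `pd`, `latLen`); the
group data `(G, d)` with the two invariance classes and `|g| = d(ε, g)` (`absG`), the pure-average predicate
`IsPureAverage` ((4) = III (1.2)) are those of `Federbush1986/PureAverages`.  The structure `BlockSpinSystem` carries:
the Lie algebra `𝔤` (a real normed space, `|A|² = −Tr A²` its norm squared) with its bracket (for `A ∧ A` in the continuum
action) and `exp : 𝔤 → G`; the 2⁴ paths `Γ_x` as WORDS in `M` fine-edge variables `e_α` («If there are M elements in
{e_α}», p. 21) — the hidden maximal-tree choice of I — with the map `vars r e : Fin M → Edge (r+1)` naming them; the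
function `Φ` of the 2⁴ path variables («the same function … for all the BS_r»), from which `BS_r` is DEFINED (`blockSpin`);
and the small-field logarithmic form `F = F^L + F′` of (14)–(18) (`F`, `FL`), linked to `Φ` by `exp ∘ F = Φ ∘ hol ∘ exp` on a
ball (field `F_spec`).  Print's properties 1)–2), (17), (21)–(23), the Definition (8)–(9), Theorems 1–2 and the bounds
(25)–(31) are predicates on `S : BlockSpinSystem`; print asserts them for Federbush's transformation (III).  READINGS
flagged in the docstrings: (17) complex-analytic ⇒ typed real-analytic (weaker-than-print, F7); «D for a derivative of F′
with respect to any z_i» ⇒ operator norms of the first/second Fréchet derivatives; (28)'s `|A(e, r₀)|` ⇒ `|g(e, r₀)| =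
d(ε, g(e, r₀))` (equal by (5)–(6) for small fields); the sup norms `|A(r)|`, `|δA(r)|` over the infinitely many edges of a
level are typed POINTWISE (all edge variables bounded by `M`), never as a real `⨆` (junk `0` when unbounded); `𝔤` is finite-dimensional and complete (fields `instFD`,
`instComplete`; print: compact `G`) so the Bochner integrals of (7) and of the continuum action are not junk; Theorem 2's
«S^r_0 converge» carries the summability of (10) and the integrability of the continuum density as explicit conjuncts.
v2 (this filing) = the revision asked by the review of p239817 (items 1–3); `PrintedProperties` bundles the printed
properties a consumer must assume of `S` before quoting any of the typed claims.

**v3 (this filing; reader r19 gen 2 as F6 re-file owner, cell rulings G.5-24/G.5-34; statements/typing of v1–v2 by reader r17).**  v2 (r17, p243092 / r19, p243267) answered the review of p239817 (pointwise sup norms, summability/integrability conjuncts); the reviews of the two v2 filings asked for (i) `𝔤` complete/finite-dimensional (fields `instFD`, `instComplete`: the Bochner integrals of (7) and of the continuum action are genuine) and (ii) a FORMAL standing hypothesis instead of a docstring contract: `IsFederbushSystem S` (Federbush's path words `Γ_x` of I Fig. 1–2 with the comb maximal tree, `F^L` = the abelian averaging of I, properties 1)–2), (13)–(23)) is now the explicit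 antecedent of `Theorem1`, `Theorem2`, `Eq12LimitExists`, `Eq25`, `Eq26`, `Eq28`, `Eq31` — the witness of the p243267 review (empty paths, `F ≡ 0`) no longer satisfies the antecedent, and for a non-Federbush `S` the typed facts claim nothing.  This is r17's reviewed v2 text with exactly these two additions.

**v4.** Review of p244506 (v3): the standing hypothesis must also tie `exp` to the metric and record compactness — `IsFederbushSystem` gains (e) `exp_norm : ∃ ρ > 0, Lemma10Normalisation S.exp ρ` (VI (5)–(6) = III Lemma 1.0) and (f) `compact : CompactSpace S.G`; the reviewer's model (`exp ≡ 1`, `G = ℝ`) no longer satisfies the antecedent («Everything else checked faithful»).  By the same logic the two remaining free data of the carrier are tied down as print has them: (g) `exp_line` (`e^{(s+t)A} = e^{sA}e^{tA}`: `exp` is an exponential map, VI p. 19) and (h) `lie_commutator` (the bracket in `A ∧ A` is the infinitesimal group commutator of `exp`, BCH III (1.6)–(1.9)) — otherwise `lie := 0` on a non-abelian `G` would again satisfy the antecedent and falsify `Theorem2`.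

**v5 (APPEND-ONLY; reader typing note T-F6-2 of the F-fold owner r17 gen 3, ruling of the file owner r19 gen 5).**  ERRATUM on
the v1–v4 READING of the plaquette sum in (10).  Print: «S^r_0 = ¼ Σ_p |g_{∂p}|² (10) where the sum is over plaquettes in ℒ^r»
(p. 20) and «The lattice actions likewise approach the continuum action ½∫(dA + A ∧ A)²» (p. 18).  v1–v4 typed the sum over
UNORIENTED plaquettes (`plaqActionTerm`: each geometric plaquette once, `dir₁ < dir₂`) and the continuum action as
`contActionVI = ½ ∫ Σ_{μ<ν} |∂_μA_ν − ∂_νA_μ + [A_μ, A_ν]|²` (`(dA + A ∧ A)²` = the pointwise norm `F ∧ *F` of the curvature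
2-form).  These two readings are INCONSISTENT by a factor 2: at leading order `log g_{∂p} = ℓ_r² F_{μν}(x) + O(ℓ_r³)` (BCH; the
carrier's `lie_commutator`, `exp_norm`), each site of `ℒ^r` carries 6 unoriented plaquettes and `Σ_{x∈ℒ^r} ℓ_r⁴ f(x) → ∫f`,
so `¼ Σ_{unoriented} |g_{∂p}|² → ¼ ∫ Σ_{μ<ν} |F_{μν}|² = ½ · contActionVI`, not `contActionVI` — `Theorem2` AS TYPED in v1–v4
asserts twice the actual limit.  READING OF RECORD (v5): «the sum is over plaquettes» = over ORIENTED plaquettes, i.e. over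
the ordered pairs of distinct directions (`dir₁ ≠ dir₂`; `|g_{∂p}|` does not depend on the orientation, `absG_plaqHol_swap`),
under which (10) = `¼ Σ_{oriented} |g_{∂p}|² = ½ Σ_{unoriented} |g_{∂p}|²` (`latticeActionOriented_eq_two_mul`) is the
small-field Wilson action of I/III and tends to `½ ∫ Σ_{μ<ν} |F_{μν}|² = contActionVI` — the one reading under which the
printed constants `¼` (10) and `½` (p. 18; I p. 319 «the Wilson actions likewise approach the continuum action ½∫(dA)²»)
agree.  Following the cell's erratum practice (no rewriting of filed history: v4's `plaqActionTerm`, `latticeActionVI`,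
`Theorem2` keep their bodies and gain ERRATUM notes), the corrected objects are NEW declarations `plaqActionTermOriented`,
`latticeActionOriented`, `Theorem2Oriented` (the statement of record for row F6.Thm2 / (10) from v5 on), with the
bookkeeping PROVED: `Plaq.swap`/`plaqHol_swap` (reversing the orientation inverts the holonomy), `summable_plaqActionTermOriented_iff`,
`latticeActionOriented_eq_two_mul`, and `theorem2Oriented_iff_half` (the corrected claim ⇔ «`latticeActionVI` → ½·`contActionVI`»,
exhibiting the factor 2 against v4's `Theorem2` at kernel level).  Second part of T-F6-2 (owner ruling, as for T-F6-1): a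
Phase-2 proof of Theorem 2 needs the Baker–Campbell–Hausdorff comparison UNIFORMLY on a ball, which the carrier field
`lie_commutator` (pointwise, infinitesimal) does not supply; it is to be carried as an explicit binder of the proof theorem
(`hBCH : ∃ ρ > 0, ∃ C, ∀ X Y, ‖X‖ < ρ → ‖Y‖ < ρ → dist (exp X * exp Y) (exp (X + Y + ½[X, Y])) ≤ C (‖X‖ + ‖Y‖)³`, true for
compact matrix groups), not as a new field of `IsFederbushSystem` — no statement of this file changes for it.
-/

namespace Literature.MathematicalPhysics.QuantumFieldTheory.Federbush1986

noncomputable section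

open MeasureTheory Filter
open scoped BigOperators Topology

/-- The holonomy of a WORD in edge variables: «g_Γ = g(e₁)·g(e₂)⋯g(e_n) (2) where Γ is composed of the compatibly oriented
edges e₁, …, e_n in the indicated order» — a letter `(α, true)` contributes `g α`, `(α, false)` (reversed edge) `g α⁻¹`.
(A namesake `Balaban1983to89.wordHol` exists in `T4TiltOscillation` on a different carrier — distinct namespace, no relation.)
[cite: Federbush1987PhaseCellVI, (2) p. 18] -/
def wordHol {G : Type*} [Group G] {ι : Type*} (g : ι → G) : List (ι × Bool) → G
  | [] => 1
  | (α, b) :: w => (if b then g α else (g α)⁻¹) * wordHol g w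

/-- The ABELIAN analogue of `wordHol`: the signed sum `A_Γ = Σ_α ±A(e_α)` of a `𝔤`-valued (or real) assignment along a
word («For any oriented path, `Γ`, `A_Γ = Σ_α A(e_α)`, where `Γ` is composed of the `e_α`, with proper orientations», I p. 322;
«F^L … the linear terms are the same as in the Abelian theory treated in I», VI p. 21).
[cite: Federbush1986PhaseCellI, (1.1)–(1.2) p. 322; Federbush1987PhaseCellVI, (18) p. 21] -/
def wordSum {V : Type*} [AddCommGroup V] {ι : Type*} (a : ι → V) : List (ι × Bool) → V
  | [] => 0
  | (α, b) :: w => (if b then a α else -a α) + wordSum a w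

/-- The 2⁴ vertices of a block: `x : Fin 16 ↦` its offset in `{0,1}⁴` (binary digits) from the base point («the "base point" of
a "block" of 2⁴ vertices in `ℒ^{r+1}` … the base point will be a corner of the block», I p. 321).
[cite: Federbush1986PhaseCellI, §1 p. 321] -/
def blockOffset (x : Fin 16) : Fin 4 → ℤ := fun μ => if Nat.testBit x.val μ.val then 1 else 0

/-- The part of an offset `o ∈ {0,1}⁴` in the coordinates `ν < μ` (the vertex reached by the comb tree path before its `μ`-th
step). [cite: Federbush1986PhaseCellI, §1 Fig. 1–2 p. 321–322] -/
def prefOffset (o : Fin 4 → ℤ) (μ : Fin 4) : Fin 4 → ℤ := fun ν => if ν < μ then o ν else 0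

/-- The lattice unit vector `δ_μ` in integer coordinates. [cite: Federbush1986PhaseCellI, §1 p. 321] -/
def intUnit (μ : Fin 4) : Fin 4 → ℤ := Pi.single μ 1

/-- The base point `A` (in `ℒ^{r+1}` integer coordinates) of the block of the SOURCE vertex of `e ∈ ℒ^r`: the same point of `ℝ⁴`,
`2·e.base` («To each vertex in `ℒ^r`, there is associated a vertex in `ℒ^{r+1}` (the same point in `R⁴`), the "base point" of a
"block"», I p. 321). [cite: Federbush1986PhaseCellI, §1 Fig. 1 p. 321] -/
def srcBase {r : ℕ} (e : Edge r) : Fin 4 → ℤ := fun k => 2 * e.base k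

/-- The base point `B` of the block of the TARGET vertex of `e`: `2·(e.base + δ_{e.dir})`. [cite: Federbush1986PhaseCellI, §1 Fig. 1 p. 321] -/
def tgtBase {r : ℕ} (e : Edge r) : Fin 4 → ℤ := fun k => 2 * e.base k + 2 * intUnit e.dir k

/-- The comb (lexicographic maximal-tree) path INSIDE the block with base point `b`, from `b` up to the vertex `b + o`: for
`μ = 0, 1, 2, 3` in turn, the edge in direction `μ` from `b + prefOffset o μ`, traversed forward, whenever `o_μ = 1` («along
portions of the maximal trees», I p. 321–322 — ONE admissible maximal tree, fixed here; print allows any).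
[cite: Federbush1986PhaseCellI, §1 Fig. 2 p. 322] -/
def combUp (r : ℕ) (b o : Fin 4 → ℤ) : List (Edge (r + 1) × Bool) :=
  (List.finRange 4).filterMap fun μ => if o μ = 1 then some (⟨b + prefOffset o μ, μ⟩, true) else none

/-- The same tree path traversed BACKWARDS, from `b + o` down to the base point `b`. [cite: Federbush1986PhaseCellI, §1 Fig. 2 p. 322] -/
def combDown (r : ℕ) (b o : Fin 4 → ℤ) : List (Edge (r + 1) × Bool) :=
  ((List.finRange 4).filterMap fun μ => if o μ = 1 then some (⟨b + prefOffset o μ, μ⟩, false) else none).reverse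

/-- The «straight line segment joining `x` and `x′`» (I p. 322): the two fine edges in the direction of `e` from `x = A + o` to
`x′ = B + o`. [cite: Federbush1986PhaseCellI, §1 Fig. 2 p. 322] -/
def straightSeg (r : ℕ) (e : Edge r) (o : Fin 4 → ℤ) : List (Edge (r + 1) × Bool) :=
  [(⟨srcBase e + o, e.dir⟩, true), (⟨srcBase e + o + intUnit e.dir, e.dir⟩, true)]

/-- Federbush's path `Γ_x` of the coarse edge `e ∈ ℒ^r` for the block vertex `x`, as a word of fine edges of `ℒ^{r+1}`: base
point `A` → (comb tree of the source block) → `x` → (straight segment) → `x′` → (comb tree of the target block, backwards) →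
base point `B` («`Γ_x` is a path between base points, along portions of the maximal trees and a straight line segment joining
`x` and `x′`», I p. 321–322, Fig. 2; cf. (1.2): `A_{Γ₁} = A(e_a) + A(e_b) + A(e_d) − A(e_g)`).
[cite: Federbush1986PhaseCellI, §1 Fig. 1–2, (1.1)–(1.2) p. 321–322] -/
def canonWord (r : ℕ) (e : Edge r) (x : Fin 16) : List (Edge (r + 1) × Bool) :=
  combUp r (srcBase e) (blockOffset x) ++ straightSeg r e (blockOffset x) ++ combDown r (tgtBase e) (blockOffset x)

/-- The carrier of VI (see the module docstring, F6). [cite: Federbush1987PhaseCellVI, (1)–(6) p. 18–19, (13)–(18) p. 21] -/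
structure BlockSpinSystem where
  /-- «a compact simple Lie group, G» -/
  G : Type
  [instGroup : Group G]
  /-- «the invariant distance on G arising from an invariant metric» -/
  [instMetric : MetricSpace G]
  [instIsoL : IsIsometricSMul G G]
  [instIsoR : IsIsometricSMul Gᵐᵒᵖ G]
  /-- the Lie algebra of `G`, normed by `|A|² = −Tr A²` (5), (20) -/
  𝔤 : Type
  [instNACG : NormedAddCommGroup 𝔤]
  [instNS : NormedSpace ℝ 𝔤]
  /-- print's `G` is a compact, hence finite-dimensional, Lie group: `𝔤` is finite-dimensional (and complete, so that the
  Bochner integrals in (7) and in the continuum action are genuine integrals, not junk `0`) -/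
  [instFD : FiniteDimensional ℝ 𝔤]
  [instComplete : CompleteSpace 𝔤]
  /-- the Lie bracket (for `A ∧ A` in the continuum action `½∫(dA + A ∧ A)²`, p. 18) -/
  lie : 𝔤 →ₗ[ℝ] 𝔤 →ₗ[ℝ] 𝔤
  /-- the exponential map, «g = e^A, meaning u(g) = e^A» -/
  exp : 𝔤 → G
  /-- number of fine edges `e_α` entering one block spin determination -/
  M : ℕ
  /-- the fine edges `e_α ∈ ℒ^{r+1}` «involved in the block spin transformation determination of g(e)» (p. 20), in a fixed
  order -/
  vars : (r : ℕ) → Edge r → Fin M → Edge (r + 1)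
  /-- the 2⁴ paths `Γ_x` of Figure 2 of I as words in the `e_α` (maximal trees + straight segment; hidden choice) -/
  paths : Fin 16 → List (Fin M × Bool)
  /-- «g(e) will be a function of the g_{Γ_x}» — the same for all `BS_r` -/
  Φ : (Fin 16 → G) → G
  /-- the small-field logarithmic form of the transformation, `A(e) = F({A(e_α)})` (18) -/
  F : (Fin M → 𝔤) → 𝔤
  /-- «F^L is exactly the linear portion of the transformation, made up of the linear terms in (14)» -/
  FL : (Fin M → 𝔤) →L[ℝ] 𝔤
  /-- (13)–(14), (18): for small `A(e_α)`, `e^{F({A(e_α)})}` IS the block spin of the `e^{A(e_α)}` — the radius is part of the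
  data («for the A(e_α) small enough») -/
  εF : ℝ
  εF_pos : 0 < εF
  F_spec : ∀ A : Fin M → 𝔤, (∀ α, ‖A α‖ < εF) →
    exp (F A) = Φ (fun x => wordHol (fun α => exp (A α)) (paths x))

attribute [instance] BlockSpinSystem.instGroup BlockSpinSystem.instMetric BlockSpinSystem.instIsoL
  BlockSpinSystem.instIsoR BlockSpinSystem.instNACG BlockSpinSystem.instNS BlockSpinSystem.instFD
  BlockSpinSystem.instComplete

namespace BlockSpinSystem

variable (S : BlockSpinSystem)

/-- `BS_r : ℱ^{r+1} → ℱ^r` DEFINED from `Φ` and the path words: `g(e) = Φ((g_{Γ_x})_x)`. (Print indexes `BS_r : ℱ̂^r →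
ℱ̂^{r−1}` (1); here `blockSpin r` goes from level `r + 1` to level `r`.) [cite: Federbush1987PhaseCellVI, (1)–(2) p. 18] -/
def blockSpin (r : ℕ) (u : Edge (r + 1) → S.G) : Edge r → S.G :=
  fun e => S.Φ fun x => wordHol (fun α => u (S.vars r e α)) (S.paths x)

/-- Iterated block spin from level `r` down to level `s ≤ r` (identity for `s ≥ r`'s excess: defined by recursion on
`r − s`). [cite: Federbush1987PhaseCellVI, (1) p. 18, (11)–(12) p. 20] -/
def iterBlockSpin : (s r : ℕ) → (Edge r → S.G) → (Edge s → S.G)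
  | s, r, u =>
    if h : s < r then
      iterBlockSpin s (r - 1) (by
        have : r - 1 + 1 = r := Nat.sub_add_cancel (Nat.one_le_of_lt h)
        exact fun e => S.blockSpin (r - 1) (this ▸ u) e)
    else if h' : s = r then h' ▸ u else fun _ => 1
  termination_by s r _ => r - s

/-- A COMPATIBLE set of assignments = a point of the inverse limit of (1): each level is the block spin of the next.
[cite: Federbush1987PhaseCellVI, (1) and the 'inverse limit' paragraph p. 18] -/
def Compatible (g : (r : ℕ) → Edge r → S.G) : Prop := ∀ r, S.blockSpin r (g (r + 1)) = g r

/-- **Property 1)** «The function is continuous.» [cite: Federbush1987PhaseCellVI, property 1) p. 18] -/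
def Property1 : Prop := Continuous S.Φ

/-- **Property 2)** «There is an ε > 0, such that if |g_{Γ_x}| < ε, all 2⁴ x (3) then g(e) is defined by minimizing
Σ_x d²(g(e), g_{Γ_x}). (4)» — with `|g| = d(Id, g)` (6) = `absG` and the minimiser predicate `IsPureAverage` of III (1.2).
[cite: Federbush1987PhaseCellVI, property 2) (3)–(4) p. 19] -/
def Property2 : Prop :=
  ∃ ε > (0 : ℝ), ∀ gs : Fin 16 → S.G, (∀ x, absG (gs x) < ε) → IsPureAverage gs (S.Φ gs)

/-! ## Analyticity and estimates (13)–(23) -/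

/-- The non-linear part «F′» of (18): `F = F^L + F′`. [cite: Federbush1987PhaseCellVI, (18) p. 21] -/
def Fprime (A : Fin S.M → S.𝔤) : S.𝔤 := S.F A - S.FL A

/-- **(14)–(18)**: «the transformation from the g(e_α) to g(e) may be viewed as given by r complex analytic functions (for
the A(e_α) small enough) … The f_i are analytic for |z_l| < ε′. (17) … the f_i have no constant terms, and … the linear terms
are the same as in the Abelian theory treated in I. We write A(e) = F({A(e_α)}) = F^L({A(e_α)}) + F′({A(e_α)}) (18) where F^L is
exactly the linear portion».  TYPED: `F` is (real-)analytic on a ball about `0` (READING weaker-than-print: complex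
analyticity of the complexified coordinates is not typed), `F 0 = 0`, and `F^L` is the derivative of `F` at `0`.  The
identification of `F^L` with the abelian averaging of I is recorded in the docstring only (different carriers).
[cite: Federbush1987PhaseCellVI, (13)–(18) p. 21] -/
def AnalyticStructure : Prop :=
  ∃ ε' > (0 : ℝ), (∀ A : Fin S.M → S.𝔤, (∀ α, ‖A α‖ < ε') → AnalyticAt ℝ S.F A) ∧ S.F 0 = 0 ∧ HasFDerivAt S.F S.FL 0

/-- **(19)–(23)**: with «‖A(e_α)‖ = Sup_α |A(e_α)| (19)» and «|A|² = −Tr(A²) (20)», «Then we have |F′| ≤ c‖A(e_α)‖² (21) |DF′| ≤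
c‖A(e_α)‖, |DDF′| ≤ c (22) both for ‖A(e_α)‖ < ε″. (23) We have written D for a derivative of F′ with respect to any z_i on
which it depends.»  TYPED with the sup norm of `Fin M → 𝔤` and operator norms of the first and second Fréchet derivatives
of `F′` (READING). [cite: Federbush1987PhaseCellVI, (19)–(23) p. 21] -/
def Estimates21to23 : Prop :=
  ∃ c : ℝ, ∃ ε'' > (0 : ℝ), ∀ A : Fin S.M → S.𝔤, ‖A‖ < ε'' →
    ‖S.Fprime A‖ ≤ c * ‖A‖ ^ 2 ∧
    DifferentiableAt ℝ S.Fprime A ∧ ‖fderiv ℝ S.Fprime A‖ ≤ c * ‖A‖ ∧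
    DifferentiableAt ℝ (fderiv ℝ S.Fprime) A ∧ ‖fderiv ℝ (fderiv ℝ S.Fprime) A‖ ≤ c

/-! ## Federbush's path system (Figure 1–2 and (1.1)–(1.2) of I) and the hypothesis predicate `IsFederbushSystem` (v3) -/

/-- **The standing hypothesis under which print asserts Theorems 1–2 and (24)–(31)** (review of p243267): `S` IS Federbush's
block spin scheme — (a) the 2⁴ path words `Γ_x`, read through `vars r e`, are EXACTLY the paths of I p. 321–322 («`Γ_x` is a
path between base points, along portions of the maximal trees and a straight line segment joining `x` and `x′`»; Fig. 2),
here with the maximal tree of each block FIXED to be the lexicographic comb tree (one admissible choice: print allows «the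
particular (arbitrary) choice of maximal tree in each block», I p. 325 — fixing one choice only NARROWS the class of schemes,
so nothing stronger than print is typed): `canonWord`; (b) «F^L is exactly the linear portion of the transformation … the
linear terms are the same as in the Abelian theory treated in I» (VI p. 21) with I (1.1) «`A(e)` is the average over the
`A_{Γ_x}`», i.e. `F^L({A(e_α)}) = 2^{−4} Σ_x A_{Γ_x}`, `A_Γ = Σ_α ±A(e_α)` (`wordSum`); (c) print's properties 1), 2) of the
block spin function (VI p. 18–19); (d) the analytic structure (13)–(18) and the estimates (21)–(23) (VI p. 21; derived in
print for Federbush's function, carried here as hypotheses — weaker than print, never stronger); (e) the tie between the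
invariant metric and the exponential map, `|e^A| = |A|` for small `A` (VI (5)–(6) p. 19 «All this notation follows III» = III
Lemma 1.0, the imported `Lemma10Normalisation`), without which `g₀(e, A) = e^{∫_e A}` (7) would float free of the metric of
(9); (f) `G` compact («a compact simple Lie group, G», VI p. 17–18); (g)–(h) `exp` is an exponential map (a homomorphism on
lines, «`g = e^A`, meaning `u(g) = e^A`», VI p. 19) whose infinitesimal commutator is the bracket `lie` used in `A ∧ A` (VI p. 18;
BCH, III (1.6)–(1.9)) — so that neither `exp` nor `lie` floats free of the group `G`.  Every printed CLAIM below
(`Theorem1`, `Theorem2`, `Eq12LimitExists`, `Eq25`, `Eq26`, `Eq28`, `Eq31`) has `S.IsFederbushSystem` as an explicit antecedent,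
so that for a scheme that is not Federbush's the typed fact claims nothing.
[cite: Federbush1987PhaseCellVI, (1)–(7) p. 17–19, (13)–(23) p. 21; Federbush1986PhaseCellI, §1 Fig. 1–2, (1.1)–(1.2) p. 321–322; Federbush1987PhaseCellIII, Lemma 1.0 (1.3), (1.6)–(1.9) p. 295] -/
structure IsFederbushSystem (S : BlockSpinSystem) : Prop where
  /-- (a) the realised path words are Federbush's `Γ_x` (comb maximal trees + straight segment), for every level and edge -/
  paths_canonical : ∀ (r : ℕ) (e : Edge r) (x : Fin 16),
    (S.paths x).map (fun l => (S.vars r e l.1, l.2)) = canonWord r e x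
  /-- (b) `F^L` = the abelian (Bałaban) averaging of I on the path variables: the mean over `x` of the signed sums `A_{Γ_x}` -/
  FL_abelian : ∀ A : Fin S.M → S.𝔤, S.FL A = (16 : ℝ)⁻¹ • ∑ x : Fin 16, wordSum A (S.paths x)
  /-- (c) property 1): continuity -/
  property1 : S.Property1
  /-- (c) property 2): small-field minimisation (3)–(4) -/
  property2 : S.Property2
  /-- (d) the analytic structure (13)–(18) -/
  analytic : S.AnalyticStructure
  /-- (d) the estimates (21)–(23) -/
  estimates : S.Estimates21to23
  /-- (e) the metric and the exponential are tied as in print: «If `u(g) = e^A` with `A` « small » we may set `d²(Id, g) = −Tr A²`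
  (5) … `|g| = d(Id, g)` (6). All this notation follows III» (VI p. 19) = III Lemma 1.0 (1.3) p. 295 «`d²(ε, e^A) = A² ≡ −Tr(A²) ≡
  |A|²`» for `|A|` small: `|e^A| = |A|` on some ball (the imported `Lemma10Normalisation`; review of p244506) -/
  exp_norm : ∃ ρ > (0 : ℝ), Lemma10Normalisation S.exp ρ
  /-- (f) «a compact simple Lie group, `G`» (VI p. 17–18): `G` is compact (simplicity is not used by any typed statement and is
  recorded in prose only; review of p244506) -/
  compact : CompactSpace S.G
  /-- (g) «`g = e^A`, meaning `u(g) = e^A`» (VI p. 19): `exp` IS an exponential map — a homomorphism on every line of `𝔤`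
  (one-parameter subgroups; the property III uses in Lemma 5.2, cf. the hypothesis `hline` of the imported `abs_exp_le_norm`) -/
  exp_line : ∀ (A : S.𝔤) (s t : ℝ), S.exp ((s + t) • A) = S.exp (s • A) * S.exp (t • A)
  /-- (h) the bracket `lie` of `𝔤` (the `A ∧ A` of the continuum action `½∫(dA + A ∧ A)²`, VI p. 18) IS the infinitesimal
  group commutator of `exp` (Baker–Campbell–Hausdorff to second order, III (1.6)–(1.9) p. 295):
  `d(e^{tA}e^{tB}e^{−tA}e^{−tB}, e^{t²[A,B]}) = o(t²)` as `t → 0` -/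
  lie_commutator : ∀ A B : S.𝔤,
    Tendsto (fun t : ℝ => (t ^ 2)⁻¹ *
      dist (S.exp (t • A) * S.exp (t • B) * (S.exp (t • A))⁻¹ * (S.exp (t • B))⁻¹) (S.exp (t ^ 2 • S.lie A B)))
      (𝓝[≠] 0) (𝓝 0)

/-! ## Results: `g₀(e, A)` (7), the Definition (8)–(9), Theorem 1, the action (10), Theorem 2, (11)–(12) -/

/-- A `𝔤`-valued continuum potential `A_μ(x)`. [cite: Federbush1987PhaseCellVI, p. 18] -/
abbrev Potential := E4 → Fin 4 → S.𝔤

/-- «g₀(e, A_μ) … the group element obtained by exponentiating ∫_e A⃗·d⃗s (7) where the line integral is along a straight line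
joining the vertices of e in the proper orientation.» [cite: Federbush1987PhaseCellVI, (7) p. 19] -/
def g0 {r : ℕ} (A : S.Potential) (e : Edge r) : S.G :=
  S.exp (∫ t in (0 : ℝ)..latLen r, A (e.src + t • unitVec e.dir) e.dir)

/-- «c(e) is the center of edge e» (p. 19). [cite: Federbush1987PhaseCellVI, (9) p. 19] -/
def edgeCenter {r : ℕ} (e : Edge r) : E4 := e.src + (latLen r / 2) • unitVec e.dir

/-- **DEFINITION** (p. 19). «Let A_μ(x) be a continuously differentiable gauge potential. We say a compatible set of lattice
assignments {g(e_α)} is associated to A_μ(x) if there is a σ(r) > 0 satisfying lim_{r→∞} σ(r) = 0 (8) and a continuous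
function on R⁴, m(x) > 0, such that for all e_α  d(g(e_α), g₀(e_α, A_μ)) < (1/2^{r(α)}) σ(r(α)) m(c(e_α)) (9) where e_α is in
ℒ^{r(α)} and c(e) is the center of edge e.» [cite: Federbush1987PhaseCellVI, Definition (8)–(9) p. 19] -/
def IsAssociated (A : S.Potential) (g : (r : ℕ) → Edge r → S.G) : Prop :=
  S.Compatible g ∧
    ∃ σ : ℕ → ℝ, (∀ r, 0 < σ r) ∧ Tendsto σ atTop (𝓝 0) ∧
      ∃ m : E4 → ℝ, Continuous m ∧ (∀ x, 0 < m x) ∧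
        ∀ (r : ℕ) (e : Edge r), dist (g r e) (S.g0 A e) < latLen r * σ r * m (edgeCenter e)

/-- **THEOREM 1.** «There is a unique set of compatible lattice assignments associated to each continuously differentiable
A_μ(x).» (proof: the construction (11)–(12) with the bounds (24)–(31), pp. 20–23). v3: stated under the explicit antecedent `S.IsFederbushSystem` (Federbush's scheme), for which alone print asserts it. [cite: Federbush1987PhaseCellVI,
Theorem 1 p. 20] -/
def Theorem1 : Prop :=
  S.IsFederbushSystem → ∀ A : S.Potential, ContDiff ℝ 1 A → ∃! g : (r : ℕ) → Edge r → S.G, S.IsAssociated A g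

/-- The plaquette holonomy `g_{∂p} = g(e₁)g(e₂)g(e₃)⁻¹g(e₄)⁻¹` (III p. 297: «g_{∂P} may be understood as g₁g₂g₃g₄, …»; the size
`|g_{∂p}|` is independent of the starting vertex by conjugation invariance, `abs_conj`). [cite: Federbush1987PhaseCellVI,
(10) p. 20] -/
def plaqHol {r : ℕ} (u : Edge r → S.G) (p : Plaq r) : S.G :=
  u ⟨p.base, p.dir₁⟩ * u ⟨p.base + Pi.single p.dir₁ 1, p.dir₂⟩ *
    (u ⟨p.base + Pi.single p.dir₂ 1, p.dir₁⟩)⁻¹ * (u ⟨p.base, p.dir₂⟩)⁻¹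

/-- The summand of (10): `|g_{∂p}|²` on the unoriented plaquettes (`dir₁ < dir₂`), `0` on the others.
**ERRATUM (v5, T-F6-2).** This is the v1–v4 READING «each geometric plaquette once»; with the prefactor `¼` of (10) it yields
HALF of the lattice action whose limit is `contActionVI` (see the module docstring, v5).  Kept unchanged (filed history); the
reading of record is `plaqActionTermOriented` (`= plaqActionTerm p + plaqActionTerm p.swap`, `plaqActionTermOriented_eq_add_swap`).
[cite: Federbush1987PhaseCellVI, (10) p. 20] -/
def plaqActionTerm (r : ℕ) (u : Edge r → S.G) (p : Plaq r) : ℝ :=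
  if p.dir₁ < p.dir₂ then absG (S.plaqHol u p) ^ 2 else 0

/-- **(10)** «We assume the lattice action on ℒ^r is given by S^r_0 = ¼ Σ_p |g_{∂p}|² (10) where the sum is over plaquettes in
ℒ^r. (We actually need this to be the expression for the action only when all |g_{∂p}| are sufficiently small.)» — sum over
unoriented plaquettes, as a `tsum` (junk `0` when the family is not summable; every statement below that uses it asserts the
summability explicitly).  **ERRATUM (v5, T-F6-2).** With the unoriented summand this is `½ ×` the action of record
`latticeActionOriented` (`latticeActionOriented_eq_two_mul`); its limit along an associated family is `½ · contActionVI`, not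
`contActionVI` (module docstring, v5).  Kept unchanged (filed history). [cite: Federbush1987PhaseCellVI, (10) p. 20] -/
def latticeActionVI (r : ℕ) (u : Edge r → S.G) : ℝ := (1 / 4 : ℝ) * ∑' p : Plaq r, S.plaqActionTerm r u p

/-- The continuum Yang–Mills density `Σ_{μ<ν} |∂_μA_ν − ∂_νA_μ + [A_μ, A_ν]|²(x)` («(dA + A ∧ A)²», p. 18; `|·|` the norm of `𝔤`,
(5), (20)). [cite: Federbush1987PhaseCellVI, p. 18] -/
def contActionDensity (A : S.Potential) (x : E4) : ℝ :=
  ∑ μ : Fin 4, ∑ ν : Fin 4,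
    if μ < ν then
      ‖fderiv ℝ (fun y => A y ν) x (unitVec μ) - fderiv ℝ (fun y => A y μ) x (unitVec ν) + S.lie (A x μ) (A x ν)‖ ^ 2
    else 0

/-- The continuum Yang–Mills action «½ ∫ (dA + A ∧ A)²» (p. 18) (Bochner integral; junk `0` when the density is not
integrable — the statements using it assert integrability explicitly). [cite: Federbush1987PhaseCellVI, p. 18] -/
def contActionVI (A : S.Potential) : ℝ := (1 / 2 : ℝ) * ∫ x : E4, S.contActionDensity A x

/-- **THEOREM 2.** «Assume A_μ(x) is continuously differentiable, and that A_μ(x) and its first partials fall off at infinity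
faster than 1/x^{2+ε} (i. e. ||x|^{2+ε}A_μ(x)| < c and likewise for DA_μ(x)). Then, for the compatible set of lattice
assignments associated to A_μ(x), the corresponding lattice actions, S^r_0, converge to the continuum action as r → ∞.»
(«We will not detail the proof of Theorem 2», p. 23.)  TYPED with the finiteness that «the corresponding lattice actions …
converge to the continuum action» presupposes made EXPLICIT conjuncts of the conclusion (so that no consumer reads a statement
about `tsum`/Bochner junk values): every `S^r_0` is a convergent plaquette sum, the continuum density is integrable, and
`S^r_0 → ½∫(dA + A∧A)²`. v3: stated under the explicit antecedent `S.IsFederbushSystem` (Federbush's scheme), for which alone print asserts it.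
**ERRATUM (v5, T-F6-2).** AS TYPED here (v1–v4 reading of (10): unoriented plaquette sum `latticeActionVI`) the conclusion
asserts the limit `contActionVI`, which is TWICE the actual limit of `latticeActionVI` (`¼∫Σ_{μ<ν}|F_{μν}|² = ½·contActionVI`;
module docstring, v5): this predicate is NOT the statement of record of Theorem 2 — that is `Theorem2Oriented` (oriented sum,
`theorem2Oriented_iff_half`).  Kept unchanged (filed history; no declaration of the tree uses it). [cite: Federbush1987PhaseCellVI, Theorem 2 p. 20] -/
def Theorem2 : Prop :=
  S.IsFederbushSystem → ∀ A : S.Potential, ContDiff ℝ 1 A →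
    (∃ ε > (0 : ℝ), ∃ c : ℝ, ∀ x : E4, ∀ μ, ‖x‖ ^ (2 + ε) * ‖A x μ‖ < c ∧
        ∀ ν, ‖x‖ ^ (2 + ε) * ‖fderiv ℝ (fun y => A y μ) x (unitVec ν)‖ < c) →
      ∀ g : (r : ℕ) → Edge r → S.G, S.IsAssociated A g →
        (∀ r, Summable (S.plaqActionTerm r (g r))) ∧
        MeasureTheory.Integrable (S.contActionDensity A) ∧
        Tendsto (fun r => S.latticeActionVI r (g r)) atTop (𝓝 (S.contActionVI A))

/-- **(11)** «For a fixed r₀, we construct assignments on ℒ^{r₀} by setting g(e, r₀) = g₀(e, A_μ) (11) for e in ℒ^{r₀}. The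
g(e, r₀) for all e with level e < r₀ are then determined by the block spin transformations» — the r₀-approximate at level
`s`. [cite: Federbush1987PhaseCellVI, (11) p. 20] -/
def gApprox (A : S.Potential) (r₀ s : ℕ) : Edge s → S.G := S.iterBlockSpin s r₀ (fun e => S.g0 A e)

/-- **(12)** «We then define the lattice assignments associated to A_μ(x) by g(e) = lim_{r₀→∞} g(e, r₀) (12) We must of course
prove this limit exists.» — the existence-of-the-limit statement (for `C¹` potentials; convergence proved via (31) «along
with the uniform bounds on |DA_μ(x)| and |A_μ(x)|», p. 23). v3: stated under the explicit antecedent `S.IsFederbushSystem` (Federbush's scheme), for which alone print asserts it. [cite: Federbush1987PhaseCellVI, (12) p. 20, p. 23] -/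
def Eq12LimitExists : Prop :=
  S.IsFederbushSystem → ∀ A : S.Potential, ContDiff ℝ 1 A → (∃ B, ∀ x μ, ‖A x μ‖ ≤ B) →
    (∃ B, ∀ x μ ν, ‖fderiv ℝ (fun y => A y μ) x (unitVec ν)‖ ≤ B) →
      ∀ (s : ℕ) (e : Edge s), ∃ g : S.G, Tendsto (fun r₀ => S.gApprox A r₀ s e) atTop (𝓝 g)

/-! ## Final inductive bounds (24)–(28) and the two-data bound (29)–(31) -/

/-- The block spin in logarithmic coordinates, `A(e) = F({A(e_α)})` (18), as a map on `𝔤`-valued configurations (meaningful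
«in a region where (21) and (22) hold», p. 22). [cite: Federbush1987PhaseCellVI, (18) p. 21, (24) p. 22] -/
def blockSpinLog (r : ℕ) (a : Edge (r + 1) → S.𝔤) : Edge r → S.𝔤 := fun e => S.F fun α => a (S.vars r e α)

/-- Iterated logarithmic block spin from level `r` down to `s ≤ r` — «the configuration at level s (s < r) as determined by
the block spin transformations» (p. 22). [cite: Federbush1987PhaseCellVI, (24) p. 22] -/
def iterBlockSpinLog : (s r : ℕ) → (Edge r → S.𝔤) → (Edge s → S.𝔤)
  | s, r, a =>
    if h : s < r then
      iterBlockSpinLog s (r - 1) (by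
        have : r - 1 + 1 = r := Nat.sub_add_cancel (Nat.one_le_of_lt h)
        exact fun e => S.blockSpinLog (r - 1) (this ▸ a) e)
    else if h' : s = r then h' ▸ a else fun _ => 0
  termination_by s r _ => r - s

/-! ### How the sup norms of pp. 22–23 are typed
«We write |A(r)| for the Sup_{e_i∈ℒ^r} |A(e_i)|» (p. 22) and «|δA(r)| = Sup_{e_α∈ℒ^r} |A₁(e_α) − A₂(e_α)|» (p. 23) range over
the INFINITE set of edges of `ℒ^r`; print's hypotheses `|A(r)| = 2^{−r}a`, `‖A(e_α)‖ < ε″` mean that EVERY edge variable is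
small.  A real-valued `⨆` would take the junk value `0` on unbounded configurations, so every sup-norm HYPOTHESIS and
CONCLUSION below is stated POINTWISE (`∀ e, ‖cfg e‖ ≤ M`), i.e. through arbitrary upper bounds `M` of the sup — for bounded
configurations this is exactly the printed sup-norm statement ((25)'s right-hand side is monotone in the bounds), and
unbounded configurations satisfy no hypothesis.  (Review of the first filing, p239817, item 1.) -/

/-- **(25)**: from the schematic (24) «A(s) = L^{s,r}A(r) + L^{s,r−1}N^{r−1}(A(r)) + … + N^s(A(s + 1)) (24)», «from (24), path
averaging considerations of I, and (21) |A(s)| ≤ c2^{r−s}|A(r)| + c2^{r−s−1}|A(r)|² + c2^{r−s−2}|A(r − 1)|² + … + c|A(s + 1)|².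
(25)» — valid «in a region where (21) and (22) hold» (every level `j`, `s ≤ j ≤ r`, has all its edge variables of size
`< ε″`); `A(j)` = the level-`j` configuration determined from `A(r)` (`iterBlockSpinLog j r`).  TYPED POINTWISE (see the note
above): for any bounds `M j ≥ 0` of the levels `j = s+1, …, r` (all `< ε″`, and level `s` in the region too), every edge
variable at level `s` is bounded by `c·2^{r−s}·M r + Σ_{j=s+1}^{r} c·2^{j−s−1}·(M j)²`.
v3: stated under the explicit antecedent `S.IsFederbushSystem` (Federbush's scheme), for which alone print asserts it. [cite: Federbush1987PhaseCellVI, (24)–(25) p. 22] -/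
def Eq25 : Prop :=
  S.IsFederbushSystem → ∃ c : ℝ, ∃ ε'' > (0 : ℝ), ∀ (r s : ℕ), s < r → ∀ (a : Edge r → S.𝔤) (M : ℕ → ℝ),
    (∀ j, s ≤ j → j ≤ r → 0 ≤ M j ∧ M j < ε'' ∧ ∀ e : Edge j, ‖S.iterBlockSpinLog j r a e‖ ≤ M j) →
      ∀ e : Edge s, ‖S.iterBlockSpinLog s r a e‖
        ≤ c * 2 ^ (r - s) * M r + ∑ j ∈ Finset.Icc (s + 1) r, c * 2 ^ (j - s - 1) * M j ^ 2

/-- **(26)–(27)**: «We set |A(r)| = 2^{−r}a. Then if s₀ is large enough, depending only on a and c (of (25)), we find |A(r′)| ≤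
2c2^{−r′}a (26) for s₀ < r′ < r, by inductive use of (25). In particular one needs 2 ≥ [1 + c²a2^{−s₀+1}]. (27)» — TYPED
POINTWISE (every edge variable at level `r` of size `≤ 2^{−r}a` — READING `≤` for print's `=` — implies every edge variable at
each level `r′`, `s₀ < r′ < r`, of size `≤ 2c2^{−r′}a`), with `c` the constant of (25) (existential, chosen before `a`).
v3: stated under the explicit antecedent `S.IsFederbushSystem` (Federbush's scheme), for which alone print asserts it. [cite: Federbush1987PhaseCellVI, (26)–(27) p. 22] -/
def Eq26 : Prop :=
  S.IsFederbushSystem → ∃ c : ℝ, ∀ a > (0 : ℝ), ∃ s₀ : ℕ, ∀ (r : ℕ) (cfg : Edge r → S.𝔤),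
    (∀ e, ‖cfg e‖ ≤ latLen r * a) →
      ∀ r', s₀ < r' → r' < r → ∀ e : Edge r', ‖S.iterBlockSpinLog r' r cfg e‖ ≤ 2 * c * latLen r' * a

/-- **(28)**: «From this we deduce |A(e, r₀)| ≤ c′2^{−r(e)} (28) for r(e) greater than some r̄, and all r₀. We have here also
used the uniform bounds on |A_μ(x)|. (28) plays the role of (2.6) in I.» — for the two-run construction (11) from a `C¹`
potential with uniformly bounded `A_μ` and `DA_μ`.  READING: `|A(e, r₀)|` typed as `|g(e, r₀)| = d(ε, g(e, r₀))` ((5)–(6)).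
v3: stated under the explicit antecedent `S.IsFederbushSystem` (Federbush's scheme), for which alone print asserts it. [cite: Federbush1987PhaseCellVI, (28) p. 22] -/
def Eq28 : Prop :=
  S.IsFederbushSystem → ∀ A : S.Potential, ContDiff ℝ 1 A → (∃ B, ∀ x μ, ‖A x μ‖ ≤ B) →
    (∃ B, ∀ x μ ν, ‖fderiv ℝ (fun y => A y μ) x (unitVec ν)‖ ≤ B) →
      ∃ c' : ℝ, ∃ rbar : ℕ, ∀ (r₀ s : ℕ), rbar < s → s ≤ r₀ →
        ∀ e : Edge s, absG (S.gApprox A r₀ s e) ≤ c' * latLen s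

/-- **(29)–(31)** (the two-data bound): «We consider two sets of assignments at level r, A₁(r) and A₂(r). We assume |A_i(r)| ≤
2^{−r}a i = 1, 2 (29) and (with b < 1) |δA(r)| ≤ 2^{−r}ba (30) where |δA(r)| = Sup_{e_α∈ℒ^r} |A₁(e_α) − A₂(e_α)|. We then
inductively use (25), (21), and (22) to find |δA(r′)| ≤ 2c2^{−r′}ba (31) for s̄₀ < r′ < r. (s̄₀ depends only on a and c.)» —
TYPED POINTWISE (see the note before `Eq25`). v3: stated under the explicit antecedent `S.IsFederbushSystem` (Federbush's scheme), for which alone print asserts it. [cite: Federbush1987PhaseCellVI, (29)–(31) p. 23] -/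
def Eq31 : Prop :=
  S.IsFederbushSystem → ∃ c : ℝ, ∀ a > (0 : ℝ), ∃ s₀ : ℕ, ∀ (b : ℝ), 0 < b → b < 1 → ∀ (r : ℕ) (cfg₁ cfg₂ : Edge r → S.𝔤),
    (∀ e, ‖cfg₁ e‖ ≤ latLen r * a) → (∀ e, ‖cfg₂ e‖ ≤ latLen r * a) →
      (∀ e, ‖cfg₁ e - cfg₂ e‖ ≤ latLen r * b * a) →
        ∀ r', s₀ < r' → r' < r →
          ∀ e : Edge r', ‖S.iterBlockSpinLog r' r cfg₁ e - S.iterBlockSpinLog r' r cfg₂ e‖ ≤ 2 * c * latLen r' * b * a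

/-! ### For consumers: under which hypotheses print asserts Theorems 1–2 and (25)–(31) -/

/-- The printed properties of the block spin function, bundled: 1) continuity, 2) small-field minimisation (3)–(4), the
analytic structure (13)–(18) and the estimates (21)–(23).  Print asserts `Theorem1`, `Theorem2`, `Eq12LimitExists`, `Eq25`,
`Eq26`, `Eq28`, `Eq31` for FEDERBUSH'S transformation (III), which has these properties; a consumer quoting any of those
predicates for a scheme `S` should carry `S.PrintedProperties` (at least) as the hypothesis under which the citation applies —
the predicates are NOT claimed for an arbitrary `S`. (Review of p239817, item 3.)  Since v3/v4 the claims themselves carry the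
STRONGER standing hypothesis `S.IsFederbushSystem` (these four properties + Federbush's path words + `F^L` = abelian averaging
+ the metric/exponential normalisation (5)–(6) + compactness of `G` + `exp` a line-homomorphism whose infinitesimal
commutator is `lie`) as an explicit antecedent; `PrintedProperties` is kept as the
named bundle of the four printed properties (`IsFederbushSystem.printedProperties`). [cite: Federbush1987PhaseCellVI, properties
1)–2) p. 18–19, (13)–(23) p. 21] -/
def PrintedProperties : Prop :=
  S.Property1 ∧ S.Property2 ∧ S.AnalyticStructure ∧ S.Estimates21to23

/-- Federbush's scheme has the printed properties (they are conjuncts (c)–(d) of `IsFederbushSystem`; v3).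
[cite: Federbush1987PhaseCellVI, properties 1)–2) p. 18–19, (13)–(23) p. 21] -/
theorem IsFederbushSystem.printedProperties {S : BlockSpinSystem} (h : S.IsFederbushSystem) : S.PrintedProperties :=
  ⟨h.property1, h.property2, h.analytic, h.estimates⟩

end BlockSpinSystem

/-! ## v5 (append-only) — the normalisation of (10): oriented plaquette sum (T-F6-2, see the module docstring)

«S^r_0 = ¼ Σ_p |g_{∂p}|² (10) where the sum is over plaquettes in ℒ^r» (p. 20).  Reading of record: `p` ranges over the
ORIENTED plaquettes of `ℒ^r` = the elements of `Plaq r` with `dir₁ ≠ dir₂` (both orders of the two directions; the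
degenerate index pairs `dir₁ = dir₂` are no plaquettes).  Reversing the orientation inverts `g_{∂p}` and leaves `|g_{∂p}|`
unchanged, so (10) `= ½ Σ_{unoriented} |g_{∂p}|²`, the small-field Wilson action, whose limit along the family associated to
`A` is `½ ∫ Σ_{μ<ν} |∂_μA_ν − ∂_νA_μ + [A_μ, A_ν]|² = contActionVI A` = «½ ∫ (dA + A ∧ A)²» (p. 18). -/

/-- The same geometric plaquette with the opposite orientation: the two directions exchanged.
[cite: Federbush1987PhaseCellVI, (10) p. 20] -/
def Plaq.swap {r : ℕ} (p : Plaq r) : Plaq r := ⟨p.base, p.dir₂, p.dir₁⟩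

/-- `swap` is an involution. [cite: Federbush1987PhaseCellVI, (10) p. 20] -/
@[simp] theorem Plaq.swap_swap {r : ℕ} (p : Plaq r) : p.swap.swap = p := by
  cases p; rfl

/-- Orientation reversal as a permutation of `Plaq r` (for reindexing the plaquette sum).
[cite: Federbush1987PhaseCellVI, (10) p. 20] -/
def Plaq.swapEquiv (r : ℕ) : Plaq r ≃ Plaq r where
  toFun := Plaq.swap
  invFun := Plaq.swap
  left_inv := Plaq.swap_swap
  right_inv := Plaq.swap_swap

/-- Reindexing a plaquette sum by orientation reversal. [cite: Federbush1987PhaseCellVI, (10) p. 20] -/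
theorem Plaq.tsum_swap {r : ℕ} (f : Plaq r → ℝ) : ∑' p : Plaq r, f p.swap = ∑' p : Plaq r, f p :=
  (Plaq.swapEquiv r).tsum_eq f

/-- A plaquette family is summable iff its orientation-reversed reindexing is. [cite: Federbush1987PhaseCellVI, (10) p. 20] -/
theorem Plaq.summable_swap_iff {r : ℕ} (f : Plaq r → ℝ) : (Summable fun p : Plaq r => f p.swap) ↔ Summable f :=
  (Plaq.swapEquiv r).summable_iff

namespace BlockSpinSystem

variable (S : BlockSpinSystem)

/-- Reversing the orientation of a plaquette inverts its holonomy: `g_{∂p̄} = g_{∂p}⁻¹` (III p. 297: the boundary word read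
backwards). [cite: Federbush1987PhaseCellVI, (10) p. 20; Federbush1987PhaseCellIII, (3.1)–(3.2) p. 296–297] -/
theorem plaqHol_swap {r : ℕ} (u : Edge r → S.G) (p : Plaq r) : S.plaqHol u p.swap = (S.plaqHol u p)⁻¹ := by
  simp only [plaqHol, Plaq.swap, mul_inv_rev, inv_inv, mul_assoc]

/-- `|g_{∂p}|` does not depend on the orientation (III Lemma 5.3 `|g| = |g⁻¹|`).
[cite: Federbush1987PhaseCellVI, (10) p. 20; Federbush1987PhaseCellIII, Lemma 5.3 (5.6) p. 299] -/
theorem absG_plaqHol_swap {r : ℕ} (u : Edge r → S.G) (p : Plaq r) :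
    absG (S.plaqHol u p.swap) = absG (S.plaqHol u p) := by
  rw [plaqHol_swap, abs_inv]

/-- **The summand of (10), reading of record (v5):** `|g_{∂p}|²` for every ORIENTED plaquette `p` (`dir₁ ≠ dir₂`), `0` on the
degenerate index pairs. [cite: Federbush1987PhaseCellVI, (10) p. 20] -/
def plaqActionTermOriented (r : ℕ) (u : Edge r → S.G) (p : Plaq r) : ℝ :=
  if p.dir₁ ≠ p.dir₂ then absG (S.plaqHol u p) ^ 2 else 0

/-- **(10), reading of record (v5):** «S^r_0 = ¼ Σ_p |g_{∂p}|² where the sum is over plaquettes in ℒ^r» — over the ORIENTED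
plaquettes (as a `tsum`; junk `0` when not summable, and every statement using it asserts the summability explicitly).
[cite: Federbush1987PhaseCellVI, (10) p. 20] -/
def latticeActionOriented (r : ℕ) (u : Edge r → S.G) : ℝ :=
  (1 / 4 : ℝ) * ∑' p : Plaq r, S.plaqActionTermOriented r u p

/-- The v4 summand is non-negative. [cite: Federbush1987PhaseCellVI, (10) p. 20] -/
theorem plaqActionTerm_nonneg (r : ℕ) (u : Edge r → S.G) (p : Plaq r) : 0 ≤ S.plaqActionTerm r u p := by
  unfold plaqActionTerm
  split_ifs <;> positivity

/-- The oriented summand is non-negative. [cite: Federbush1987PhaseCellVI, (10) p. 20] -/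
theorem plaqActionTermOriented_nonneg (r : ℕ) (u : Edge r → S.G) (p : Plaq r) :
    0 ≤ S.plaqActionTermOriented r u p := by
  unfold plaqActionTermOriented
  split_ifs <;> positivity

/-- The oriented summand is orientation-symmetric. [cite: Federbush1987PhaseCellVI, (10) p. 20] -/
theorem plaqActionTermOriented_swap (r : ℕ) (u : Edge r → S.G) (p : Plaq r) :
    S.plaqActionTermOriented r u p.swap = S.plaqActionTermOriented r u p := by
  unfold plaqActionTermOriented
  rw [S.absG_plaqHol_swap u p]
  simp only [Plaq.swap, ne_comm]

/-- Oriented summand = unoriented summand of `p` + unoriented summand of the reversed plaquette `p.swap` (exactly one of the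
two is the `dir₁ < dir₂` representative when `dir₁ ≠ dir₂`). [cite: Federbush1987PhaseCellVI, (10) p. 20] -/
theorem plaqActionTermOriented_eq_add_swap (r : ℕ) (u : Edge r → S.G) (p : Plaq r) :
    S.plaqActionTermOriented r u p = S.plaqActionTerm r u p + S.plaqActionTerm r u p.swap := by
  have hsw := S.absG_plaqHol_swap u p
  unfold plaqActionTermOriented plaqActionTerm
  simp only [Plaq.swap] at hsw ⊢
  rcases lt_trichotomy p.dir₁ p.dir₂ with h | h | h
  · rw [if_pos (ne_of_lt h), if_pos h, if_neg (lt_asymm h), add_zero]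
  · simp [h]
  · rw [if_pos (ne_of_gt h), if_neg (lt_asymm h), if_pos h, hsw, zero_add]

/-- The oriented plaquette family is summable iff the unoriented one is. [cite: Federbush1987PhaseCellVI, (10) p. 20] -/
theorem summable_plaqActionTermOriented_iff (r : ℕ) (u : Edge r → S.G) :
    Summable (S.plaqActionTermOriented r u) ↔ Summable (S.plaqActionTerm r u) := by
  constructor
  · intro h
    refine Summable.of_nonneg_of_le (S.plaqActionTerm_nonneg r u) (fun p => ?_) h
    rw [S.plaqActionTermOriented_eq_add_swap]
    exact le_add_of_nonneg_right (S.plaqActionTerm_nonneg r u _)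
  · intro h
    have h' : Summable fun p : Plaq r => S.plaqActionTerm r u p.swap :=
      (Plaq.summable_swap_iff (S.plaqActionTerm r u)).2 h
    have := h.add h'
    refine this.congr fun p => ?_
    rw [S.plaqActionTermOriented_eq_add_swap]

/-- **(10) oriented = ½ Σ_{unoriented}:** `¼ Σ_{oriented} |g_{∂p}|² = 2 · (¼ Σ_{unoriented} |g_{∂p}|²)` — unconditionally (both
sides are the junk `0` when the family is not summable). [cite: Federbush1987PhaseCellVI, (10) p. 20] -/
theorem latticeActionOriented_eq_two_mul (r : ℕ) (u : Edge r → S.G) :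
    S.latticeActionOriented r u = 2 * S.latticeActionVI r u := by
  unfold latticeActionOriented latticeActionVI
  by_cases hs : Summable (S.plaqActionTerm r u)
  · have h' : Summable fun p : Plaq r => S.plaqActionTerm r u p.swap :=
      (Plaq.summable_swap_iff (S.plaqActionTerm r u)).2 hs
    have hfun : S.plaqActionTermOriented r u = fun p => S.plaqActionTerm r u p + S.plaqActionTerm r u p.swap :=
      funext (S.plaqActionTermOriented_eq_add_swap r u)
    rw [hfun, hs.tsum_add h', Plaq.tsum_swap (S.plaqActionTerm r u)]
    ring
  · have hns : ¬ Summable (S.plaqActionTermOriented r u) := fun h =>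
      hs ((S.summable_plaqActionTermOriented_iff r u).1 h)
    rw [tsum_eq_zero_of_not_summable hs, tsum_eq_zero_of_not_summable hns]
    ring

/-- **THEOREM 2, statement of record (v5).** «Assume A_μ(x) is continuously differentiable, and that A_μ(x) and its first
partials fall off at infinity faster than 1/x^{2+ε} (i. e. ||x|^{2+ε}A_μ(x)| < c and likewise for DA_μ(x)). Then, for the
compatible set of lattice assignments associated to A_μ(x), the corresponding lattice actions, S^r_0, converge to the
continuum action as r → ∞.» («We will not detail the proof of Theorem 2», p. 23.)  Verbatim the typing of `Theorem2` (explicit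
antecedent `S.IsFederbushSystem`; summability of every `S^r_0` and integrability of the continuum density as explicit
conjuncts) with the plaquette sum of (10) over ORIENTED plaquettes (`plaqActionTermOriented`, `latticeActionOriented`) — the
reading under which (10) and «½∫(dA + A ∧ A)²» (p. 18) carry consistent constants (module docstring v5, T-F6-2).  A Phase-2
proof needs, beyond the chart binder of T-F6-1, a uniform second-order BCH binder (module docstring v5).
[cite: Federbush1987PhaseCellVI, Theorem 2 p. 20, (10) p. 20, p. 18, p. 23] -/
def Theorem2Oriented : Prop :=
  S.IsFederbushSystem → ∀ A : S.Potential, ContDiff ℝ 1 A →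
    (∃ ε > (0 : ℝ), ∃ c : ℝ, ∀ x : E4, ∀ μ, ‖x‖ ^ (2 + ε) * ‖A x μ‖ < c ∧
        ∀ ν, ‖x‖ ^ (2 + ε) * ‖fderiv ℝ (fun y => A y μ) x (unitVec ν)‖ < c) →
      ∀ g : (r : ℕ) → Edge r → S.G, S.IsAssociated A g →
        (∀ r, Summable (S.plaqActionTermOriented r (g r))) ∧
        MeasureTheory.Integrable (S.contActionDensity A) ∧
        Tendsto (fun r => S.latticeActionOriented r (g r)) atTop (𝓝 (S.contActionVI A))

/-- Doubling a real sequence doubles its limit: `2·f → c ⇔ f → ½·c`. [cite: Federbush1987PhaseCellVI, (10) p. 20] -/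
theorem tendsto_two_mul_iff (f : ℕ → ℝ) (c : ℝ) :
    Tendsto (fun r => 2 * f r) atTop (𝓝 c) ↔ Tendsto f atTop (𝓝 ((1 / 2 : ℝ) * c)) := by
  constructor
  · intro h
    have := h.const_mul (1 / 2 : ℝ)
    simpa [← mul_assoc] using this
  · intro h
    have := h.const_mul (2 : ℝ)
    simpa [← mul_assoc] using this

/-- **The factor 2 at kernel level.** The statement of record `Theorem2Oriented` is EQUIVALENT to v4's typing with the limit
`½ · contActionVI` in place of `contActionVI`: in the v4 reading (`latticeActionVI`, unoriented sum) the lattice actions of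
the associated family tend to HALF of `contActionVI`.  (So `Theorem2` of v4 and `Theorem2Oriented` make incompatible claims
for every scheme and potential admitting an associated family with `contActionVI A ≠ 0`.)
[cite: Federbush1987PhaseCellVI, Theorem 2 p. 20, (10) p. 20] -/
theorem theorem2Oriented_iff_half :
    S.Theorem2Oriented ↔
      (S.IsFederbushSystem → ∀ A : S.Potential, ContDiff ℝ 1 A →
        (∃ ε > (0 : ℝ), ∃ c : ℝ, ∀ x : E4, ∀ μ, ‖x‖ ^ (2 + ε) * ‖A x μ‖ < c ∧
            ∀ ν, ‖x‖ ^ (2 + ε) * ‖fderiv ℝ (fun y => A y μ) x (unitVec ν)‖ < c) →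
          ∀ g : (r : ℕ) → Edge r → S.G, S.IsAssociated A g →
            (∀ r, Summable (S.plaqActionTerm r (g r))) ∧
            MeasureTheory.Integrable (S.contActionDensity A) ∧
            Tendsto (fun r => S.latticeActionVI r (g r)) atTop (𝓝 ((1 / 2 : ℝ) * S.contActionVI A))) := by
  unfold Theorem2Oriented
  simp only [summable_plaqActionTermOriented_iff, latticeActionOriented_eq_two_mul, tendsto_two_mul_iff]

end BlockSpinSystem

end

end Literature.MathematicalPhysics.QuantumFieldTheory.Federbush1986
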